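import Summits.HodgeConjecture.CorCM.MultiFieldWeilSeparatedTowerBlocks
import HarnessLib

/-!
# MULTI-FIELD WEIL ENGINE — SEPARATED GROUPS, EACH A PAIR OR A CUBIC TOWER: the general consumer of the gen-35 splitting (threefold groups pairwise separated; each group at
# most two simple CM threefolds, or a cubic tower over its own imaginary quadratic field; simple CM surfaces up to the dihedral-triple limit; any CM elliptic curves) — the
# Hodge conjecture for every product of copies, given ONLY Markman's fourfold theorem

Cell `pub-hodgecm2` (COR-CM), seat b30 gen 35 (2026-08-25); count-neutral own lane MULTI-FIELD WEIL ENGINE (stem `MultiFieldWeil*`); the common roof of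
`CorCM/MultiFieldWeilSeparatedThreefoldPairsAnyCurves.lean` ∕ `…SurfaceBlockClosures.lean` (groups of ≤ 2) and `CorCM/MultiFieldWeilSeparatedTowerBlocks.lean` (tower groups).
Theorems only; no definition, no named fact, no `sorry`.  HONEST FRAMING: conditional on the displayed Markman fourfold binder only; `HC_CM` is NOT proved and not asserted.

THE STATEMENT (**`hodgeConjectureFor_prod_of_separatedPairsAndTowers_of_markman`**).  `A_i ⊨ (K_i; Φ_i)` (`i ∈ I` finite, one index type) SIMPLE of dimension `≤ 3`; a labelling
`b : I → C₁ ⊕ C₂` of the slots with differently labelled sextic slots SEPARATED (different Galois closures, no common imaginary quadratic subfield); PAIR labels `inl c₁`: at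
most two sextic slots carry the label; TOWER labels `inr c₂`: the sextic slots with the label are among a cubic tower `e_{c₂} : Fin r_{c₂} → I` over an imaginary quadratic
field `k_{c₂}` (N8's data `i, τ, s, hs, htower`); (iii′) among any three quartic slots with one Galois closure two carry isogenous surfaces; any quadratic slots.  Then the Hodge
conjecture holds for every product of copies `⨁_j A_{π j}`, GIVEN ONLY `Markman2025_weilClasses_algebraic_abelianFourfold`; with the dominated form.  PROOF:
`hodgeConjectureFor_prod_of_separatedLabels` (gen 35, unconditional splitting) with, per label, gen 35's `hodgeConjectureFor_prod_threefoldBlock_of_markman` (pairs, N5 inside) or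
`hodgeConjectureFor_prod_towerBlock_of_markman` (towers, N8 inside), and `hodgeConjectureFor_prod_surfaceBlock_of_closures` on the block of surfaces and free curves.

[cite: MoonenZarhin1999LowDim, Thm. (0.1), Thm. (0.2), §3 (3.1), Cor. (3.9), §5 (5.2)] [cite: Markman2025SurveySecant, Thm. 1.2] [cite: Gordon1999HodgeAVSurvey, §3 Theorem (proof), 7.4–7.7, 10.10]
[cite: Shimura1998, §8.2 Prop. 26, §8.4 (2), §18.2 Lemma (i)] [cite: MumfordAV1970, §19 Thm. 1 and p. 169]

## References
* [MoonenZarhin1999LowDim] B. Moonen, Yu. Zarhin, Math. Ann. 315 (1999) 711–733.  [Markman2025SurveySecant] E. Markman, arXiv:2509.23403, Thm. 1.2.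
  [Gordon1999HodgeAVSurvey] B. B. Gordon, *A survey of the Hodge conjecture for abelian varieties*, §3, 7.4–7.7, 10.10.  [Shimura1998] G. Shimura, *Abelian varieties with
  complex multiplication and modular functions*, §8.2, §8.4, §18.2.  [MumfordAV1970] D. Mumford, *Abelian Varieties*, §19.
-/

noncomputable section

open CategoryTheory CategoryTheory.Limits NumberField IntermediateField

namespace Summit.HodgeConjecture.CorCM.MultiFieldWeil

open Literature.AlgebraicGeometry Literature.AlgebraicGeometry.Motives Literature.AlgebraicGeometry.HodgeTheory
open Literature.AlgebraicGeometry.ComplexMultiplication (IsCMTypeRealisation)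
open Literature.AlgebraicTopology.SingularHomology
open Literature.NumberTheory.ComplexMultiplication
open Literature.AlgebraicGeometry.Pohlmann1968

open scoped Classical

section Family

variable {I : Type} [Fintype I] {K : I → Type} [∀ i, Field (K i)] [∀ i, NumberField (K i)] [∀ i, IsCMField (K i)]
  {Φ : ∀ i, CMType (K i)} {A : I → AbelianVariety ℂ} {ι : ∀ i, 𝓞 (K i) →+* End (A i)} {θ : ∀ i, K i →+* Module.End ℂ (complexBetti (A i).X 1)}
  {C₁ C₂ : Type} {r : C₂ → ℕ} {kc : C₂ → Type} [∀ c, Field (kc c)] [∀ c, NumberField (kc c)] [∀ c, IsCMField (kc c)]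

omit [Fintype I] [∀ i, IsCMField (K i)] in
/-- The CM field of a realisation of dimension `≤ 3` has degree `2`, `4` or `6`. [cite: Shimura1998, §5.2] -/
private theorem finrank_eq_or_of_dim_le_three₃₅m (hA : ∀ i, IsCMTypeRealisation (Φ i) (A i) (ι i) (θ i)) {i : I} (h3 : (A i).dim ≤ 3) :
    Module.finrank ℚ (K i) = 2 ∨ Module.finrank ℚ (K i) = 4 ∨ Module.finrank ℚ (K i) = 6 := by
  have h := finrank_eq_two_mul_dim_of_isCMTypeRealisation (hA i)
  have hpos : 0 < Module.finrank ℚ (K i) := Module.finrank_pos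
  interval_cases hd : (A i).dim <;> omega

omit [Fintype I] [∀ i, IsCMField (K i)] in
/-- An embedding of number fields `K_i ↪ K_t` makes `[K_i : ℚ]` divide `[K_t : ℚ]`. [cite: Shimura1998, §8.1] -/
private theorem finrank_dvd_of_ringHom₃₅m {i t : I} (g : K i →+* K t) : Module.finrank ℚ (K i) ∣ Module.finrank ℚ (K t) := by
  have h1 : Module.finrank ℚ ↥g.toRatAlgHom.fieldRange = Module.finrank ℚ (K i) :=
    ((AlgEquiv.ofInjectiveField g.toRatAlgHom).toLinearEquiv.finrank_eq).symm
  rw [← h1, ← IntermediateField.finrank_top' (F := ℚ) (E := K t)]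
  exact IntermediateField.finrank_dvd_of_le_right le_top

/-- **MAIN THEOREM — SEPARATED GROUPS, EACH A PAIR OR A CUBIC TOWER, SURFACES UP TO THE DIHEDRAL-TRIPLE LIMIT, ANY CURVES, given ONLY Markman's fourfold theorem.**
`A_i ⊨ (K_i; Φ_i)` (`i ∈ I` finite) SIMPLE of dimension `≤ 3`; `b : I → C₁ ⊕ C₂` with differently labelled sextic slots separated; pair labels carry at most two sextic slots;
tower labels carry the members of a cubic tower `e_{c₂}` over `k_{c₂}`; (iii′); any quadratic slots.  Then the Hodge conjecture holds for every product of copies `⨁_j A_{π j}`.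
`HC_CM` is NOT asserted. [cite: MoonenZarhin1999LowDim, Thm. (0.1), Thm. (0.2), §3 (3.1), Cor. (3.9)] [cite: Markman2025SurveySecant, Thm. 1.2]
[cite: Gordon1999HodgeAVSurvey, §3 Theorem (proof), 7.5–7.7, 10.10] -/
theorem hodgeConjectureFor_prod_of_separatedPairsAndTowers_of_markman (hW4 : Markman2025_weilClasses_algebraic_abelianFourfold)
    (hA : ∀ i, IsCMTypeRealisation (Φ i) (A i) (ι i) (θ i)) (hS : ∀ i, (A i).IsSimple) (h3 : ∀ i, (A i).dim ≤ 3) (b : I → C₁ ⊕ C₂)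
    (hsep : ∀ t t', Module.finrank ℚ (K t) = 6 → Module.finrank ℚ (K t') = 6 → b t ≠ b t' →
      normalClosure ℚ (K t) ℂ ≠ normalClosure ℚ (K t') ℂ ∧ ¬ ∃ F : IntermediateField ℚ (K t), Module.finrank ℚ F = 2 ∧ IsTotallyComplex F ∧ Nonempty (F →+* K t'))
    (hT2 : ∀ (c : C₁) (t t' t'' : I), Module.finrank ℚ (K t) = 6 → Module.finrank ℚ (K t') = 6 → Module.finrank ℚ (K t'') = 6 →
      b t = Sum.inl c → b t' = Sum.inl c → b t'' = Sum.inl c → t = t' ∨ t = t'' ∨ t' = t'')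
    (e : ∀ c, Fin (r c) → I) (h6 : ∀ c m, Module.finrank ℚ (K (e c m)) = 6)
    (hcov : ∀ t (c : C₂), Module.finrank ℚ (K t) = 6 → b t = Sum.inr c → ∃ m, t = e c m)
    (h2c : ∀ c, Module.finrank ℚ (kc c) = 2) (i : ∀ c m, kc c →+* K (e c m)) (τ : ∀ c, kc c →+* ℂ) (s : ∀ c m, K (e c m) →+* ℂ)
    (hs : ∀ c m, (s c m).comp (i c m) = τ c)
    (htower : ∀ c (m : Fin (r c)) (φ : K (e c m) →+* ℂ), φ.comp (i c m) = τ c →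
      ¬ Set.range φ ⊆ (↑(adjoin ℚ (Set.range (τ c)) ⊔ adjoin ℚ (⋃ j : {j : Fin (r c) // j < m}, Set.range (s c j.1))) : Set ℂ))
    (hS3 : ∀ x y z : I, Module.finrank ℚ (K x) = 4 → Module.finrank ℚ (K y) = 4 → Module.finrank ℚ (K z) = 4 →
      normalClosure ℚ (K x) ℂ = normalClosure ℚ (K y) ℂ → normalClosure ℚ (K y) ℂ = normalClosure ℚ (K z) ℂ →
      AbelianVariety.IsIsogenous (A x) (A y) ∨ AbelianVariety.IsIsogenous (A x) (A z) ∨ AbelianVariety.IsIsogenous (A y) (A z))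
    {N : ℕ} (π : Fin N → I) : HodgeConjectureFor (⨁ fun j => A (π j)).dim (⨁ fun j => A (π j)).X := by
  refine hodgeConjectureFor_prod_of_separatedLabels hA hS h3 b hsep (fun c M ρ hρ => ?_) (fun M ρ hρ => ?_) π
  · cases M with
    | zero => exact hodgeConjectureFor_of_isDivisorGenerated _ (isDivisorGenerated_of_dim_eq_zero _ (dim_biproduct_fin_zero _))
    | succ M =>
      obtain ⟨t₀, ht₀, -, hb₀⟩ := hρ 0
      -- every member of the block is a curve or a sextic slot of label `c`
      have hmem : ∀ l, Module.finrank ℚ (K (ρ l)) = 2 ∨ (Module.finrank ℚ (K (ρ l)) = 6 ∧ b (ρ l) = c) := fun l => by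
        obtain ⟨t, ht, ⟨g⟩, hbt⟩ := hρ l
        rcases finrank_eq_or_of_dim_le_three₃₅m hA (h3 (ρ l)) with h2 | h4 | h6'
        · exact Or.inl h2
        · exfalso
          have h := finrank_dvd_of_ringHom₃₅m g
          rw [h4, ht] at h
          omega
        · exact Or.inr ⟨h6', (label_eq_of_ringHom_ringHom hA h3 b hsep h6' ht (RingHom.id _) g).trans hbt⟩
      rcases c with c₁ | c₂
      · -- a PAIR label: at most two sextic slots `t₀, t₁`
        obtain ⟨t₁, ht₁, hcov₁⟩ : ∃ t₁, Module.finrank ℚ (K t₁) = 6 ∧ ∀ t, Module.finrank ℚ (K t) = 6 → b t = Sum.inl c₁ → t = t₀ ∨ t = t₁ := by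
          by_cases hT' : ∃ t, Module.finrank ℚ (K t) = 6 ∧ b t = Sum.inl c₁ ∧ t ≠ t₀
          · obtain ⟨t₁, ht₁, hb₁, hne⟩ := hT'
            refine ⟨t₁, ht₁, fun t ht hbt => ?_⟩
            rcases hT2 c₁ t₀ t₁ t ht₀ ht₁ ht hb₀ hb₁ hbt with h | h | h
            · exact absurd h.symm hne
            · exact Or.inl h.symm
            · exact Or.inr h.symm
          · exact ⟨t₀, ht₀, fun t ht hbt => Or.inl (by by_contra h; exact hT' ⟨t, ht, hbt, h⟩)⟩
        refine hodgeConjectureFor_prod_threefoldBlock_of_markman hW4 hA hS ht₀ ht₁ ρ fun l => ?_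
        rcases hmem l with h2 | ⟨h6', hb⟩
        · exact Or.inl h2
        · exact Or.inr (hcov₁ (ρ l) h6' hb)
      · -- a TOWER label
        have hr : 0 < r c₂ := by
          obtain ⟨m₀, -⟩ := hcov t₀ c₂ ht₀ hb₀
          exact m₀.pos
        refine hodgeConjectureFor_prod_towerBlock_of_markman hW4 hA hS hr (e c₂) (h6 c₂) (h2c c₂) (i c₂) (τ c₂) (s c₂) (hs c₂) (htower c₂) ρ fun l => ?_
        rcases hmem l with h2 | ⟨h6', hb⟩
        · exact Or.inl h2
        · exact Or.inr (hcov (ρ l) c₂ h6' hb)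
  · exact hodgeConjectureFor_prod_surfaceBlock_of_closures hA hS h3 hS3 ρ fun l h6' => hρ l ⟨ρ l, h6', ⟨RingHom.id _⟩⟩

/-- **Dominated form.** [cite: MoonenZarhin1999LowDim, Thm. (0.1), (0.2)] [cite: Markman2025SurveySecant, Thm. 1.2] [cite: MumfordAV1970, §19 Thm. 1 and p. 169] -/
theorem hodgeConjectureFor_of_avDominatedBy_prod_of_separatedPairsAndTowers_of_markman (hW4 : Markman2025_weilClasses_algebraic_abelianFourfold)
    (hA : ∀ i, IsCMTypeRealisation (Φ i) (A i) (ι i) (θ i)) (hS : ∀ i, (A i).IsSimple) (h3 : ∀ i, (A i).dim ≤ 3) (b : I → C₁ ⊕ C₂)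
    (hsep : ∀ t t', Module.finrank ℚ (K t) = 6 → Module.finrank ℚ (K t') = 6 → b t ≠ b t' →
      normalClosure ℚ (K t) ℂ ≠ normalClosure ℚ (K t') ℂ ∧ ¬ ∃ F : IntermediateField ℚ (K t), Module.finrank ℚ F = 2 ∧ IsTotallyComplex F ∧ Nonempty (F →+* K t'))
    (hT2 : ∀ (c : C₁) (t t' t'' : I), Module.finrank ℚ (K t) = 6 → Module.finrank ℚ (K t') = 6 → Module.finrank ℚ (K t'') = 6 →
      b t = Sum.inl c → b t' = Sum.inl c → b t'' = Sum.inl c → t = t' ∨ t = t'' ∨ t' = t'')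
    (e : ∀ c, Fin (r c) → I) (h6 : ∀ c m, Module.finrank ℚ (K (e c m)) = 6)
    (hcov : ∀ t (c : C₂), Module.finrank ℚ (K t) = 6 → b t = Sum.inr c → ∃ m, t = e c m)
    (h2c : ∀ c, Module.finrank ℚ (kc c) = 2) (i : ∀ c m, kc c →+* K (e c m)) (τ : ∀ c, kc c →+* ℂ) (s : ∀ c m, K (e c m) →+* ℂ)
    (hs : ∀ c m, (s c m).comp (i c m) = τ c)
    (htower : ∀ c (m : Fin (r c)) (φ : K (e c m) →+* ℂ), φ.comp (i c m) = τ c →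
      ¬ Set.range φ ⊆ (↑(adjoin ℚ (Set.range (τ c)) ⊔ adjoin ℚ (⋃ j : {j : Fin (r c) // j < m}, Set.range (s c j.1))) : Set ℂ))
    (hS3 : ∀ x y z : I, Module.finrank ℚ (K x) = 4 → Module.finrank ℚ (K y) = 4 → Module.finrank ℚ (K z) = 4 →
      normalClosure ℚ (K x) ℂ = normalClosure ℚ (K y) ℂ → normalClosure ℚ (K y) ℂ = normalClosure ℚ (K z) ℂ →
      AbelianVariety.IsIsogenous (A x) (A y) ∨ AbelianVariety.IsIsogenous (A x) (A z) ∨ AbelianVariety.IsIsogenous (A y) (A z))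
    {N : ℕ} (π : Fin N → I) {X : AbelianVariety ℂ} (hX : Domination.AVDominatedBy X (⨁ fun j => A (π j))) : HodgeConjectureFor X.dim X.X :=
  Domination.hodgeConjectureFor_of_avDominatedBy
    (hodgeConjectureFor_prod_of_separatedPairsAndTowers_of_markman hW4 hA hS h3 b hsep hT2 e h6 hcov h2c i τ s hs htower hS3 π) hX

end Family

end Summit.HodgeConjecture.CorCM.MultiFieldWeil

end
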